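import Summits.SmoothPoincare4.SmoothPoincare4.Theorems.ConvexBisectionAcyclicBisectionExistsBeltMonodromyTransit
import HarnessLib

/-!
# N1 ▸ `node_N1_move` ▸ (d) N1-mono (the deep-belt monodromy model), brick J1-(d5), part 3:
# THE TRANSIT IS THE EXCHANGE MAP IN TUBE COORDINATES — belt region for free, explicit belt coordinates,
# uniform smallness at the core line
(wave 8, crux stmt-SmoothPoincare4-10508, line `modp-braid-orbits`, registered stub `stub_M2geo` (N1) ▸
`node_N1_move` ▸ sub-node (d) = H4's `helper_N1_beltMonodromy`; geometric dictionary of piece (d5) of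
`work/stubs/H4-REPORT.md` §4, continued from `…BeltMonodromyTransit.lean`; registered sub-goal `helper_beltGlue_exchange`)

Read the input chart family `φ` of (d) in the tube coordinates of handle `k`: `φ p = h̄_k (depthLine v w' 0)` with
`v := tubeAngle (h̄_k⁻¹ (φ p))`, `w' := tubeFibre (h̄_k⁻¹ (φ p))` (the chart lands in `range h̄_k`, the SMALL clause of (d)).
By G2's gluing identity `β♭ (θ, r v) = jA h̄_k (depthLine v (r θ) 0)` (core angle and fibre direction EXCHANGED):
* §1 off the cores `w' ≠ 0`, and `D.jA (φ p) = β♭ (w'/‖w'‖, ‖w'‖ v)` read in `X`;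
* §2 hence the seam lift `Λ₀ p` of EVERY box point off the cores lies in the belt region of handle `k` (the belt-region
  hypothesis of `…BeltMonodromyTransit(Smooth)` is automatic), and the transit is EXPLICIT:
  `χ̂ p = (w'/‖w'‖, ‖w'‖ v)`, `‖(χ̂ p).2‖ = ‖w'‖`;
* §3 `p ↦ w'` is continuous on the whole box INCLUDING the core line, where it vanishes; so `‖(χ̂ p).2‖ → 0` uniformly as
  `(r', σ) → (0, 0)`: the seam-lift chart of the thin part of the box lies in any prescribed belt `‖m‖ < ε` (the
  smallness input of the region bookkeeping of pieces (d7)/(d10)).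

Everything is proved; no definitions, no named facts, no `sorry`.  References: A. A. Kosinski, *Differential Manifolds*
(1993), VI §6 [Kosinski1993]; J. Milnor, *Lectures on the h-cobordism theorem* (1965), §3 [MilnorHCobordism1965].
-/

noncomputable section

set_option linter.dupNamespace false

open scoped Manifold ContDiff Topology
open Set Function Metric Filter
open Literature.Topology.FourManifolds Literature.Topology.FourManifolds.HandleAttachingMap
  Literature.Topology.FourManifolds.LefschetzBase

namespace Summit.SmoothPoincare4.SmoothPoincare4.Theorems.AcyclicBisectionExists.ModpBraidOrbits

/-! ## §1 Tube coordinates of a chart point -/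

section Tube

variable {g n : ℕ} {h : Fin n → HandleAttachingMap 3 2 (Base g)}
  {X : Type} [TopologicalSpace X] [ChartedSpace (EuclideanHalfSpace 4) X] [IsManifold (𝓡∂ 4) ∞ X]
  (D : MultiAttachmentData h (𝓡∂ 4) X) (k : Fin n)

/-- **Tube coordinates**: a boundary point `a` of the base in the range of `h̄_k` is `h̄_k (depthLine v w' 0)` with
`(v, w') := (h̄_k)♭⁻¹ a` (the inverse of the boundary tube of `h_k`). [cite: Kosinski1993, VI §6] -/
theorem apply_depthLine_tubeCoord {a : Base g} (ha : a ∈ range (h k).toFun) (hb : a ∈ (𝓡∂ 4).boundary (Base g)) :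
    (h k).toFun (depthLine (tubeAngle ((h k).toHomeo.symm a)) (tubeFibre ((h k).toHomeo.symm a)) 0) = a := by
  have ht : (⟨a, hb⟩ : ↥((𝓡∂ 4).boundary (Base g))) ∈ (h k).boundaryTube.toHomeo.target :=
    (HandleAttachingMap.mem_boundaryTube_target_iff (h k)).2 ha
  have e := (h k).boundaryTube.toHomeo.right_inv ht
  rw [HandleAttachingMap.boundaryTube_symm_apply] at e
  exact congrArg Subtype.val e

/-- The fibre tube coordinate has norm `< 1`. [folklore] -/
theorem norm_tubeFibre_tubeCoord_lt_one (a : Base g) : ‖tubeFibre ((h k).toHomeo.symm a)‖ < 1 :=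
  norm_tubeFibre_lt_one _

/-- **Off the cores the fibre tube coordinate does not vanish.** [cite: Kosinski1993, VI §6] -/
theorem tubeFibre_tubeCoord_ne_zero {a : Base g} (ha : a ∈ range (h k).toFun) (hb : a ∈ (𝓡∂ 4).boundary (Base g))
    (hoff : a ∈ coresComplement h) : tubeFibre ((h k).toHomeo.symm a) ≠ 0 := by
  intro h0
  have e := apply_depthLine_tubeCoord k ha hb
  rw [h0, depthLine_zero_zero] at e
  have hcore : a ∈ (h k).core := by
    rw [← e]; exact (h k).attachingCircle_mem_core _
  exact (mem_coresComplement h).1 hoff k hcore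

/-- The direction of a non-zero plane vector is a unit vector. [folklore] -/
theorem inv_norm_smul_mem_sphere {w : EuclideanSpace ℝ (Fin 2)} (hw : w ≠ 0) :
    ‖w‖⁻¹ • w ∈ sphere (0 : EuclideanSpace ℝ (Fin 2)) 1 := by
  rw [mem_sphere_zero_iff_norm, norm_smul, norm_inv, norm_norm, inv_mul_cancel₀ (norm_ne_zero_iff.2 hw)]

/-- **THE EXCHANGE**: off the cores, `D.jA a = β♭ (w'/‖w'‖, ‖w'‖ v)` read in `X`, where `(v, w')` are the tube coordinates of
`a` (G2's `coe_belt_boundaryTube_polar`: core angle and fibre direction exchanged). [cite: Kosinski1993, VI §6] -/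
theorem jA_eq_beltTube_exchange {a : Base g} (ha : a ∈ range (h k).toFun) (hb : a ∈ (𝓡∂ 4).boundary (Base g))
    (hoff : a ∈ coresComplement h) :
    D.jA ⟨a, hoff⟩ = (((beltMap D k).boundaryTube.toHomeo
      (⟨‖tubeFibre ((h k).toHomeo.symm a)‖⁻¹ • tubeFibre ((h k).toHomeo.symm a),
        inv_norm_smul_mem_sphere (tubeFibre_tubeCoord_ne_zero k ha hb hoff)⟩,
        ‖tubeFibre ((h k).toHomeo.symm a)‖ • (tubeAngle ((h k).toHomeo.symm a) : EuclideanSpace ℝ (Fin 2))) :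
      ↥((𝓡∂ 4).boundary X)) : X) := by
  have hw := tubeFibre_tubeCoord_ne_zero k ha hb hoff
  have hr0 : 0 < ‖tubeFibre ((h k).toHomeo.symm a)‖ := norm_pos_iff.2 hw
  have hr1 : ‖tubeFibre ((h k).toHomeo.symm a)‖ < 1 := norm_tubeFibre_lt_one _
  rw [coe_belt_boundaryTube_polar D k (tubeAngle ((h k).toHomeo.symm a)) ⟨_, inv_norm_smul_mem_sphere hw⟩ hr0 hr1]
  congr 1
  apply Subtype.ext
  show a = (h k).toFun (depthLine (tubeAngle ((h k).toHomeo.symm a))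
    (‖tubeFibre ((h k).toHomeo.symm a)‖ • (‖tubeFibre ((h k).toHomeo.symm a)‖⁻¹ • tubeFibre ((h k).toHomeo.symm a))) 0)
  rw [smul_smul, mul_inv_cancel₀ hr0.ne', one_smul]
  exact (apply_depthLine_tubeCoord k ha hb).symm

/-- Off the cores, `D.jA a` lies in the range of the belt map of handle `k` (for `a` in the range of `h̄_k`).
[cite: Kosinski1993, VI §6] -/
theorem jA_mem_range_beltMap {a : Base g} (ha : a ∈ range (h k).toFun) (hb : a ∈ (𝓡∂ 4).boundary (Base g))
    (hoff : a ∈ coresComplement h) : D.jA ⟨a, hoff⟩ ∈ range (beltMap D k).toFun := by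
  rw [jA_eq_beltTube_exchange D k ha hb hoff]
  exact (HandleAttachingMap.mem_boundaryTube_target_iff _).1 ((beltMap D k).boundaryTube.toHomeo.map_source
    ((beltMap D k).boundaryTube.mem_source_iff.2 (by
      rw [norm_smul, norm_norm, norm_eq_of_mem_sphere, mul_one]; exact norm_tubeFibre_tubeCoord_lt_one k a)))

end Tube

/-! ## §2 The seam-lift chart is in the belt region; the transit is the exchange -/

section Transit

variable {g n : ℕ} [Nonempty (bBase g).carrier] {h : Fin n → HandleAttachingMap 3 2 (Base g)}
  {X₀ : Type} [TopologicalSpace X₀] [ChartedSpace (EuclideanHalfSpace 4) X₀]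
  (bX : BoundaryData (𝓡∂ 4) X₀ (𝓡 3)) (Ψ : bX.carrier ≃ₘ⟮𝓡 3, 𝓡 3⟯ (bBase g).carrier)
  {X : Type} [TopologicalSpace X] [ChartedSpace (EuclideanHalfSpace 4) X] [IsManifold (𝓡∂ 4) ∞ X]
  [Nonempty (BoundaryManifold.boundaryData 3 X).carrier]
  (G₀ : X₀ ≃ₘ⟮𝓡∂ 4, 𝓡∂ 4⟯ X) (D : MultiAttachmentData h (𝓡∂ 4) X) (d : Fin n → ℂ) (k : Fin n)

/-- **The belt region is automatic**: the seam lift of every box point off the cores whose chart point is in the range of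
`h̄_k` (the SMALL clause of (d)) lies in the belt region of handle `k`. [cite: Kosinski1993, VI §6] -/
theorem seamLiftChart_mem_beltRegion (hd : ‖d k‖ = 1) {η₁ : ℝ} {φ : ℝ × ℝ × ℝ → Base g}
    (hφp : ∀ u r σ, σ ∈ Icc (-η₁) η₁ → φ (u, r, σ) ∈ page g (d k * Complex.exp ((σ : ℂ) * Complex.I)))
    {p : ℝ × ℝ × ℝ} (hσ : p.2.2 ∈ Icc (-η₁) η₁) (hsmall : φ p ∈ range (h k).toFun) (hoff : φ p ∈ coresComplement h) :
    G₀ (bX.incl (seamLiftChart bX Ψ G₀ D φ p)) ∈ range (beltMap D k).toFun := by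
  have hq := hφp p.1 p.2.1 p.2.2 hσ
  rw [G₀_incl_seamLiftChart bX Ψ G₀ D (norm_dir_exp hd p.2.2) hq hoff]
  exact jA_mem_range_beltMap D k hsmall (page_subset_boundary g (norm_dir_exp hd p.2.2) hq) hoff

/-- **The transit is the exchange**: `χ̂ p = (w'/‖w'‖, ‖w'‖ v)` for the tube coordinates `(v, w')` of `φ p`.
[cite: Kosinski1993, VI §6] -/
theorem transit_eq_exchange (hd : ‖d k‖ = 1) {η₁ : ℝ} {φ : ℝ × ℝ × ℝ → Base g}
    (hφp : ∀ u r σ, σ ∈ Icc (-η₁) η₁ → φ (u, r, σ) ∈ page g (d k * Complex.exp ((σ : ℂ) * Complex.I)))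
    {p : ℝ × ℝ × ℝ} (hσ : p.2.2 ∈ Icc (-η₁) η₁) (hsmall : φ p ∈ range (h k).toFun) (hoff : φ p ∈ coresComplement h) :
    transit bX Ψ G₀ D k φ p =
      (⟨‖tubeFibre ((h k).toHomeo.symm (φ p))‖⁻¹ • tubeFibre ((h k).toHomeo.symm (φ p)),
        inv_norm_smul_mem_sphere (tubeFibre_tubeCoord_ne_zero k hsmall
          (page_subset_boundary g (norm_dir_exp hd p.2.2) (hφp p.1 p.2.1 p.2.2 hσ)) hoff)⟩,
        ‖tubeFibre ((h k).toHomeo.symm (φ p))‖ • (tubeAngle ((h k).toHomeo.symm (φ p)) : EuclideanSpace ℝ (Fin 2))) := by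
  have hq := hφp p.1 p.2.1 p.2.2 hσ
  have hb := page_subset_boundary g (norm_dir_exp hd p.2.2) hq
  -- `T⁻¹ (Λ₀ p) = β♭ (exchange)` as points of `∂X`
  set z : ↥((𝓡∂ 4).boundary X) :=
    ((BoundaryManifold.boundaryData 3 X).restrictDiffeomorph bX G₀.symm).symm (seamLiftChart bX Ψ G₀ D φ p) with hz
  have hzX : (z : X) = G₀ (bX.incl (seamLiftChart bX Ψ G₀ D φ p)) := by
    have e := G₀_incl_restrict bX G₀ z
    rw [hz, Diffeomorph.apply_symm_apply] at e
    rw [BoundaryManifold.boundaryData_incl] at e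
    exact e.symm
  rw [G₀_incl_seamLiftChart bX Ψ G₀ D (norm_dir_exp hd p.2.2) hq hoff, jA_eq_beltTube_exchange D k hsmall hb hoff] at hzX
  have hzeq := Subtype.ext hzX
  have hsrc : ((⟨‖tubeFibre ((h k).toHomeo.symm (φ p))‖⁻¹ • tubeFibre ((h k).toHomeo.symm (φ p)),
      inv_norm_smul_mem_sphere (tubeFibre_tubeCoord_ne_zero k hsmall hb hoff)⟩,
      ‖tubeFibre ((h k).toHomeo.symm (φ p))‖ • (tubeAngle ((h k).toHomeo.symm (φ p)) : EuclideanSpace ℝ (Fin 2))) :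
        sphere (0 : EuclideanSpace ℝ (Fin 2)) 1 × EuclideanSpace ℝ (Fin 2)) ∈ (beltMap D k).boundaryTube.toHomeo.source :=
    (beltMap D k).boundaryTube.mem_source_iff.2 (by
      rw [norm_smul, norm_norm, norm_eq_of_mem_sphere, mul_one]; exact norm_tubeFibre_tubeCoord_lt_one k (φ p))
  rw [transit_apply, ← hz, hzeq, (beltMap D k).boundaryTube.toHomeo.left_inv hsrc]

/-- **The fibre coordinate of the transit is `‖w'‖ v`**, of norm `‖w'‖` (the tube-fibre distance of the chart point from
the core). [cite: Kosinski1993, VI §6] -/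
theorem norm_transit_snd (hd : ‖d k‖ = 1) {η₁ : ℝ} {φ : ℝ × ℝ × ℝ → Base g}
    (hφp : ∀ u r σ, σ ∈ Icc (-η₁) η₁ → φ (u, r, σ) ∈ page g (d k * Complex.exp ((σ : ℂ) * Complex.I)))
    {p : ℝ × ℝ × ℝ} (hσ : p.2.2 ∈ Icc (-η₁) η₁) (hsmall : φ p ∈ range (h k).toFun) (hoff : φ p ∈ coresComplement h) :
    (transit bX Ψ G₀ D k φ p).2 =
        ‖tubeFibre ((h k).toHomeo.symm (φ p))‖ • (tubeAngle ((h k).toHomeo.symm (φ p)) : EuclideanSpace ℝ (Fin 2)) ∧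
      ‖(transit bX Ψ G₀ D k φ p).2‖ = ‖tubeFibre ((h k).toHomeo.symm (φ p))‖ := by
  have e := congrArg Prod.snd (transit_eq_exchange bX Ψ G₀ D d k hd hφp hσ hsmall hoff)
  refine ⟨e, ?_⟩
  rw [e, norm_smul, norm_norm, norm_eq_of_mem_sphere, mul_one]

end Transit

/-! ## §3 Uniform smallness of the fibre coordinate at the core line -/

section Small

variable {g n : ℕ} {h : Fin n → HandleAttachingMap 3 2 (Base g)} (k : Fin n)

/-- The fibre tube coordinate `p ↦ w' (φ p)` is continuous at every parameter whose chart point is in `range h̄_k`.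
[folklore] -/
theorem continuousAt_tubeFibre_chart {φ : ℝ × ℝ × ℝ → Base g} (hφs : ContMDiff 𝓘(ℝ, ℝ × ℝ × ℝ) (𝓡∂ 4) ∞ φ)
    {p : ℝ × ℝ × ℝ} (hp : φ p ∈ range (h k).toFun) :
    ContinuousAt (fun p' => tubeFibre ((h k).toHomeo.symm (φ p'))) p :=
  contMDiff_tubeFibre.continuous.continuousAt.comp
    (((h k).contMDiffAt_toHomeo_symm hp).continuousAt.comp hφs.continuous.continuousAt)

/-- On the core line the fibre tube coordinate vanishes. [folklore] -/
theorem tubeFibre_chart_core {φ : ℝ × ℝ × ℝ → Base g} (hφc : ∀ u, φ (u, 0, 0) = (h k).attachingCircle (circlePt u))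
    (u : ℝ) : tubeFibre ((h k).toHomeo.symm (φ (u, 0, 0))) = 0 := by
  rw [hφc, HandleAttachingMap.attachingCircle, HandleAttachingMap.toHomeo_symm_apply, tubeFibre_coreTubePt]

/-- **Uniform smallness at the core line**: for every `ε > 0` there is `δ > 0` with `‖w' (φ (u, r, σ))‖ < ε` whenever
`|r|, |σ| < δ` (continuity up to the core line, where `w' = 0`; `1`-periodicity in `u`; generalized tube lemma).
[folklore] -/
theorem exists_tubeFibre_chart_lt {η₁ : ℝ} (hη₁ : 0 < η₁) {φ : ℝ × ℝ × ℝ → Base g}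
    (hφs : ContMDiff 𝓘(ℝ, ℝ × ℝ × ℝ) (𝓡∂ 4) ∞ φ) (hφ1 : ∀ u r σ, φ (u + 1, r, σ) = φ (u, r, σ))
    (hφc : ∀ u, φ (u, 0, 0) = (h k).attachingCircle (circlePt u))
    (hφr : ∀ u r σ, r ∈ Ioo (-1 : ℝ) 1 → σ ∈ Icc (-η₁) η₁ → φ (u, r, σ) ∈ range (h k).toFun) {ε : ℝ} (hε : 0 < ε) :
    ∃ δ : ℝ, 0 < δ ∧ δ ≤ 1 ∧ δ ≤ η₁ ∧
      ∀ (u r σ : ℝ), |r| < δ → |σ| < δ → ‖tubeFibre ((h k).toHomeo.symm (φ (u, r, σ)))‖ < ε := by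
  set F : ℝ × ℝ × ℝ → EuclideanSpace ℝ (Fin 2) := fun p => tubeFibre ((h k).toHomeo.symm (φ p)) with hF
  set U : Set (ℝ × ℝ × ℝ) := {p | p.2.1 ∈ Ioo (-1 : ℝ) 1 ∧ p.2.2 ∈ Ioo (-η₁) η₁} with hU
  have hUo : IsOpen U := (isOpen_Ioo.preimage (continuous_fst.comp continuous_snd)).inter
    (isOpen_Ioo.preimage (continuous_snd.comp continuous_snd))
  have hFc : ContinuousOn F U := fun p hp =>
    (continuousAt_tubeFibre_chart k hφs (hφr p.1 p.2.1 p.2.2 hp.1 ⟨hp.2.1.le, hp.2.2.le⟩)).continuousWithinAt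
  have hO : IsOpen (U ∩ (fun p => ‖F p‖) ⁻¹' Iio ε) :=
    (continuous_norm.comp_continuousOn hFc).isOpen_inter_preimage hUo isOpen_Iio
  have hsub : Icc (0 : ℝ) 1 ×ˢ ({((0 : ℝ), (0 : ℝ))} : Set (ℝ × ℝ)) ⊆ U ∩ (fun p => ‖F p‖) ⁻¹' Iio ε := by
    rintro ⟨u, q⟩ ⟨-, hq⟩
    rw [mem_singleton_iff] at hq
    subst hq
    refine ⟨⟨by simp, by simp [hη₁]⟩, ?_⟩
    show ‖F (u, 0, 0)‖ < ε
    rw [hF]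
    simp only
    rw [tubeFibre_chart_core k hφc u, norm_zero]
    exact hε
  obtain ⟨A, B, -, hBo, hA, hB, hAB⟩ := generalized_tube_lemma isCompact_Icc isCompact_singleton hO hsub
  obtain ⟨δ₀, hδ₀, hball⟩ := Metric.isOpen_iff.1 hBo ((0 : ℝ), (0 : ℝ)) (hB (mem_singleton _))
  refine ⟨min δ₀ (min 1 η₁), lt_min hδ₀ (lt_min one_pos hη₁), (min_le_right _ _).trans (min_le_left _ _),
    (min_le_right _ _).trans (min_le_right _ _), fun u r σ hr hσ => ?_⟩
  have hrδ : |r| < δ₀ := lt_of_lt_of_le hr (min_le_left _ _)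
  have hσδ : |σ| < δ₀ := lt_of_lt_of_le hσ (min_le_left _ _)
  have hqB : ((r, σ) : ℝ × ℝ) ∈ B := hball (by
    rw [mem_ball, Prod.dist_eq, Real.dist_eq, Real.dist_eq, sub_zero, sub_zero]
    exact max_lt hrδ hσδ)
  -- reduce `u` to `[0, 1)` by periodicity
  have hper : Function.Periodic (fun u => F (u, r, σ)) 1 := fun u => by
    show tubeFibre ((h k).toHomeo.symm (φ (u + 1, r, σ))) = tubeFibre ((h k).toHomeo.symm (φ (u, r, σ)))
    rw [hφ1]
  have e : F (Int.fract u, r, σ) = F (u, r, σ) := by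
    have h1 := (hper.int_mul (-⌊u⌋)) u
    simp only [Int.cast_neg, mul_one] at h1
    rw [Int.fract, sub_eq_add_neg]
    exact h1
  have hmem := hAB (mk_mem_prod (hA ⟨Int.fract_nonneg u, (Int.fract_lt_one u).le⟩) hqB)
  have : ‖F (Int.fract u, r, σ)‖ < ε := hmem.2
  rwa [e] at this

end Small

/-! ## §4 The registered package -/

section Package

/-- **Sub-goal `helper_beltGlue_exchange` of stub `stub_M2geo`** (N1 ▸ `node_N1_move` ▸ (d) N1-mono, geometric dictionary of
piece (d5), part 3; wave 8, lead c5).  THE TRANSIT IS THE EXCHANGE: for the input chart family `φ` of (d) (smooth,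
`1`-periodic, core `γ_k`, level `σ ⊂ page (d k e^{iσ})` for `|σ| ≤ η₁`, small), at every box point `p = (u', r', σ)`
(`|r'| < 1`, `|σ| ≤ η₁`) off the cores: the seam lift `Λ₀ p` and `D.jA (φ p)` lie in the belt region of handle `k`, the tube
fibre `w' := tubeFibre (h̄_k⁻¹ (φ p))` is non-zero, and `(χ̂ p).2 = ‖w'‖ · v` (`v` the tube angle), `‖(χ̂ p).2‖ = ‖w'‖`; and
`‖w'‖ → 0` UNIFORMLY as `(r', σ) → (0, 0)`. [cite: Kosinski1993, VI §6] -/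
theorem helper_beltGlue_exchange : ∀ (g n : ℕ) [Nonempty (Literature.Topology.FourManifolds.LefschetzBase.bBase g).carrier] (h : Fin n → Literature.Topology.FourManifolds.HandleAttachingMap 3 2 (Literature.Topology.FourManifolds.LefschetzBase.Base g)) (X₀ : Type) [TopologicalSpace X₀] [ChartedSpace (EuclideanHalfSpace 4) X₀] (bX : Literature.Topology.FourManifolds.BoundaryData (𝓡∂ 4) X₀ (𝓡 3)) (Ψ : bX.carrier ≃ₘ⟮𝓡 3, 𝓡 3⟯ (Literature.Topology.FourManifolds.LefschetzBase.bBase g).carrier) (X : Type) [TopologicalSpace X] [ChartedSpace (EuclideanHalfSpace 4) X] [IsManifold (𝓡∂ 4) ∞ X] [Nonempty (Literature.Topology.FourManifolds.BoundaryManifold.boundaryData 3 X).carrier] (G₀ : X₀ ≃ₘ⟮𝓡∂ 4, 𝓡∂ 4⟯ X) (D : Literature.Topology.FourManifolds.HandleAttachingMap.MultiAttachmentData h (𝓡∂ 4) X) (d : Fin n → ℂ) (k : Fin n) (η₁ : ℝ) (φ : ℝ × ℝ × ℝ → Literature.Topology.FourManifolds.LefschetzBase.Base g), ‖d k‖ =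 1 → 0 < η₁ → ContMDiff 𝓘(ℝ, ℝ × ℝ × ℝ) (𝓡∂ 4) ∞ φ → (∀ u r σ, φ (u + 1, r, σ) = φ (u, r, σ)) → (∀ u, φ (u, 0, 0) = (h k).attachingCircle (Literature.Topology.FourManifolds.circlePt u)) → (∀ u r σ, σ ∈ Set.Icc (-η₁) η₁ → φ (u, r, σ) ∈ Literature.Topology.FourManifolds.LefschetzBase.page g (d k * Complex.exp ((σ : ℂ) * Complex.I))) → (∀ u r σ, r ∈ Set.Ioo (-1 : ℝ) 1 → σ ∈ Set.Icc (-η₁) η₁ → φ (u, r, σ) ∈ Set.range (h k).toFun) → (∀ (u' r' σ : ℝ), r' ∈ Set.Ioo (-1 : ℝ) 1 → σ ∈ Set.Icc (-η₁) η₁ → ∀ (hoff : φ (u', r', σ) ∈ Literature.Topology.FourManifolds.HandleAttachingMap.coresComplement h), G₀ (bX.incl (Summit.SmoothPoincare4.SmoothPoincare4.Theorems.AcyclicBisectionExists.ModpBraidOrbits.seamLiftChart bX Ψ G₀ D φ (u', r', σ))) ∈ Set.range (Summit.SmoothPoincare4.SmoothPoincare4.Theorems.AcyclicBisectionExists.ModpBraidOrbits.beltMap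 D k).toFun ∧ D.jA ⟨φ (u', r', σ), hoff⟩ ∈ Set.range (Summit.SmoothPoincare4.SmoothPoincare4.Theorems.AcyclicBisectionExists.ModpBraidOrbits.beltMap D k).toFun ∧ Literature.Topology.FourManifolds.tubeFibre ((h k).toHomeo.symm (φ (u', r', σ))) ≠ 0 ∧ (Summit.SmoothPoincare4.SmoothPoincare4.Theorems.AcyclicBisectionExists.ModpBraidOrbits.transit bX Ψ G₀ D k φ (u', r', σ)).2 = ‖Literature.Topology.FourManifolds.tubeFibre ((h k).toHomeo.symm (φ (u', r', σ)))‖ • (Literature.Topology.FourManifolds.tubeAngle ((h k).toHomeo.symm (φ (u', r', σ))) : EuclideanSpace ℝ (Fin 2)) ∧ ‖(Summit.SmoothPoincare4.SmoothPoincare4.Theorems.AcyclicBisectionExists.ModpBraidOrbits.transit bX Ψ G₀ D k φ (u', r', σ)).2‖ = ‖Literature.Topology.FourManifolds.tubeFibre ((h k).toHomeo.symm (φ (u', r', σ)))‖) ∧ (∀ ε : ℝ, 0 < ε → ∃ δ : ℝ, 0 < δ ∧ δ ≤ 1 ∧ δ ≤ η₁ ∧ ∀ (u' r' σ : ℝ),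 |r'| < δ → |σ| < δ → ‖Literature.Topology.FourManifolds.tubeFibre ((h k).toHomeo.symm (φ (u', r', σ)))‖ < ε) := by
  intro g n _ h X₀ _ _ bX Ψ X _ _ _ _ G₀ D d k η₁ φ hd hη₁ hφs hφ1 hφc hφp hφr
  refine ⟨fun u' r' σ hr hσ hoff => ?_, fun ε hε => exists_tubeFibre_chart_lt k hη₁ hφs hφ1 hφc hφr hε⟩
  have hσ' : ((u', r', σ) : ℝ × ℝ × ℝ).2.2 ∈ Icc (-η₁) η₁ := hσ
  have hsmall : φ (u', r', σ) ∈ range (h k).toFun := hφr u' r' σ hr hσ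
  have hb := page_subset_boundary g (norm_dir_exp hd σ) (hφp u' r' σ hσ)
  have hn := norm_transit_snd bX Ψ G₀ D d k hd hφp hσ' hsmall hoff
  exact ⟨seamLiftChart_mem_beltRegion bX Ψ G₀ D d k hd hφp hσ' hsmall hoff, jA_mem_range_beltMap D k hsmall hb hoff,
    tubeFibre_tubeCoord_ne_zero k hsmall hb hoff, hn.1, hn.2⟩

end Package

end Summit.SmoothPoincare4.SmoothPoincare4.Theorems.AcyclicBisectionExists.ModpBraidOrbits

end
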